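import Literature.Barriers.BirchSwinnertonDyer.RankNotSumOfLocalInvariantsProofs
import Literature.NumberTheory.EllipticCurves.TwoDescent
import HarnessLib

/-!
# `480a1` has a rational point of infinite order

Companion to `Literature/Barriers/BirchSwinnertonDyer/RankNotSumOfLocalInvariantsProofs.lean`
(the curve `curve480a1 : y² = x(x+2)(x-3) = x³ - x² - 6x`, Cremona label `480a1`, of the proof of
Theorem 2 of T. Dokchitser–V. Dokchitser, *A note on the Mordell–Weil rank modulo `n`*,
J. Number Theory 131 (2011) 1833–1839, arXiv:0910.4588) and first input of the reduction of the
descent leaf `DokchitserDokchitser2011_descent_480a1_F3` ("2-descent shows that `rk E/F₃ = 1`")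
carried out in `RankNotSumOfLocalInvariantsF3Cubic.lean`: the LOWER bound, i.e. a rational point
of infinite order.

* `curve480a1.nsmul_P_ne_zero`, `curve480a1.exists_nsmul_ne_zero`: **`P = (-1, 2) ∈ E(ℚ)` has
  infinite order** (Cremona's tables give `480a1` rank `1` with generator `(-1, 2)`; only the
  infinite order is proved, which is all the reduction needs).

Neither the Lutz–Nagell theorem nor the injectivity of reduction on torsion is in Mathlib; the
proof is a `2`-descent argument with the tree's complete `2`-descent map
`WeierstrassCurve.Affine.Point.twoDescentComponent` (`TwoDescent.lean`, Silverman AEC Prop. X.1.4;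
`δ(P + Q) = δ(P) δ(Q)` with values in `ℚˣ/(ℚˣ)²`) for the rational `2`-torsion
`e₁ = 0, e₂ = -2, e₃ = 3` (`curve480a1.splitTwoTorsion`):

1. the affine `2`-torsion points are `(0, 0), (-2, 0), (3, 0)` (`x_eq_of_two_nsmul_eq_zero`), on
   which `δ₂ = x + 2` takes the values `[2], [10], [5] ≠ 1` (`2, 10, 5` are not rational squares),
   so a `2`-torsion point in `2E(ℚ)` is `O` (`eq_zero_of_two_nsmul_eq_zero`: no rational
   `4`-torsion), and `2ᵏQ = O ⟹ 2Q = O` (`two_nsmul_eq_zero_of_two_pow_nsmul_eq_zero`);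
2. `δ(P) = ([-1], [1])`; if `nP = O`, `n = 2ᵏm` with `m` odd, then `2(mP) = O` and
   `δ(mP) = δ(P)`, so `δ₂(mP) = 1` forces `mP = O`, contradicting `δ₁(mP) = [-1] ≠ 1`.

Theorems only (no definitions: the model `E = curve480a1.baseChange ℚ`, the point `P` and the two
descent components `δ₁ = twoDescentComponent E 0 (-2) 3`, `δ₂ = twoDescentComponent E (-2) 0 3` are
spelled out); `open scoped Classical` and no `[DecidableEq]` variables, as in
`TwoDescent.lean` (over `ℚ` the group law is elaborated against `Rat`'s decidable equality in any
case). The model is `curve480a1.baseChange ℚ` (along `algebraMap ℚ ℚ`) because that is the source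
of Mathlib's `WeierstrassCurve.Affine.Point.baseChange ℚ F : E(ℚ) →+ E(F)`.

## References

* T. Dokchitser, V. Dokchitser, *A note on the Mordell–Weil rank modulo `n`*, J. Number Theory 131
  (2011) 1833–1839, arXiv:0910.4588, proof of Thm. 2 ("`E/ℚ : y² = x(x+2)(x-3)`, which is 480a1").
  [DokchitserDokchitser2011RankModN]
* J. H. Silverman, *The Arithmetic of Elliptic Curves*, 2nd ed., GTM 106 (2009), Prop. X.1.4
  (complete `2`-descent). [SilvermanAEC2009]
-/

noncomputable section

open scoped Classical

open WeierstrassCurve WeierstrassCurve.Affine WeierstrassCurve.Affine.Point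

namespace Literature.Barriers.BirchSwinnertonDyer

namespace curve480a1

/-! ### Non-squares in `ℚ` -/

/-- `2`, `5` and `10` are not squares of natural numbers. [folklore] -/
theorem not_isSquare_nat {n : ℕ} (hn : n = 2 ∨ n = 5 ∨ n = 10) : ¬ IsSquare n := by
  rintro ⟨r, hr⟩
  have hr4 : r ≤ 4 := by rcases hn with rfl | rfl | rfl <;> nlinarith
  interval_cases r <;> omega

/-- `2` is not a square in `ℚ`. [folklore] -/
theorem not_isSquare_two : ¬ IsSquare (2 : ℚ) := by
  rw [show (2 : ℚ) = ((2 : ℕ) : ℚ) by norm_num, Rat.isSquare_natCast_iff]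
  exact not_isSquare_nat (Or.inl rfl)

/-- `5` is not a square in `ℚ`. [folklore] -/
theorem not_isSquare_five : ¬ IsSquare (5 : ℚ) := by
  rw [show (5 : ℚ) = ((5 : ℕ) : ℚ) by norm_num, Rat.isSquare_natCast_iff]
  exact not_isSquare_nat (Or.inr (Or.inl rfl))

/-- `10` is not a square in `ℚ`. [folklore] -/
theorem not_isSquare_ten : ¬ IsSquare (10 : ℚ) := by
  rw [show (10 : ℚ) = ((10 : ℕ) : ℚ) by norm_num, Rat.isSquare_natCast_iff]
  exact not_isSquare_nat (Or.inr (Or.inr rfl))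

/-- `-1` is not a square in `ℚ`. [folklore] -/
theorem not_isSquare_neg_one : ¬ IsSquare (-1 : ℚ) := by
  rintro ⟨r, hr⟩
  nlinarith [mul_self_nonneg r]

/-- A non-square has non-trivial square class in `ℚˣ/(ℚˣ)²`. [folklore] -/
theorem sqClass_ne_one {a : ℚ} (ha : a ≠ 0) (h : ¬ IsSquare a) : sqClass a ≠ 1 := by
  rw [Ne, sqClass_eq_one_iff ha]
  rintro ⟨u, hu⟩
  exact h ⟨u, by rw [hu, pow_two]⟩

/-! ### The curve `E = 480a1 : y² = x³ - x² - 6x` over `ℚ` and its `2`-descent map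

Throughout, `E` stands for `(curve480a1.baseChange ℚ).toAffine`, `P` for its point `(-1, 2)`, and
`δ₁ = twoDescentComponent E 0 (-2) 3 : (x, y) ↦ [x]`, `δ₂ = twoDescentComponent E (-2) 0 3 :
(x, y) ↦ [x + 2]` for the two components of the complete `2`-descent map (spelled out). -/

/-- `a₁ = 0`. [folklore] -/
theorem E_a₁ : (curve480a1.baseChange ℚ).a₁ = 0 := by simp [WeierstrassCurve.baseChange, curve480a1]

/-- `a₂ = -1`. [folklore] -/
theorem E_a₂ : (curve480a1.baseChange ℚ).a₂ = -1 := by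
  simp [WeierstrassCurve.baseChange, curve480a1]

/-- `a₃ = 0`. [folklore] -/
theorem E_a₃ : (curve480a1.baseChange ℚ).a₃ = 0 := by simp [WeierstrassCurve.baseChange, curve480a1]

/-- `a₄ = -6`. [folklore] -/
theorem E_a₄ : (curve480a1.baseChange ℚ).a₄ = -6 := by
  simp [WeierstrassCurve.baseChange, curve480a1]

/-- `a₆ = 0`. [folklore] -/
theorem E_a₆ : (curve480a1.baseChange ℚ).a₆ = 0 := by simp [WeierstrassCurve.baseChange, curve480a1]

/-- `480a1` (base-changed to `ℚ`) is an elliptic curve. [folklore] -/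
theorem isElliptic : WeierstrassCurve.IsElliptic (curve480a1.baseChange ℚ) :=
  inferInstanceAs (curve480a1.map (algebraMap ℚ ℚ)).IsElliptic

/-- `480a1 : y² = x(x+2)(x-3)` has rational `2`-torsion with `e₁ = 0, e₂ = -2, e₃ = 3`
(`b₂ = -4 = -4 Σ eᵢ`, `b₄ = -12 = 2 Σ eᵢeⱼ`, `b₆ = 0 = -4 e₁e₂e₃`). [folklore] -/
theorem splitTwoTorsion : (curve480a1.baseChange ℚ).toAffine.SplitTwoTorsion 0 (-2) 3 := by
  constructor <;>
  norm_num [WeierstrassCurve.baseChange, curve480a1, WeierstrassCurve.b₂, WeierstrassCurve.b₄,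
    WeierstrassCurve.b₆]

/-- The equation of `480a1`: `y² = x³ - x² - 6x`. [folklore] -/
theorem equation_iff' (x y : ℚ) :
    (curve480a1.baseChange ℚ).toAffine.Equation x y ↔ y ^ 2 = x ^ 3 - x ^ 2 - 6 * x := by
  rw [WeierstrassCurve.Affine.equation_iff, E_a₁, E_a₂, E_a₃, E_a₄, E_a₆]
  constructor <;> intro h <;> linear_combination h

/-- `P = (-1, 2)` is a (nonsingular) rational point of `480a1`: `4 = -1 - 1 + 6`. [folklore] -/
theorem nonsingular_P : (curve480a1.baseChange ℚ).toAffine.Nonsingular (-1) 2 := by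
  haveI := isElliptic
  rw [← WeierstrassCurve.Affine.equation_iff_nonsingular, equation_iff']
  norm_num

/-- `δ₁` is a homomorphism (Silverman AEC Prop. X.1.4, tree `twoDescentComponent_add`).
[folklore] -/
theorem δ₁_add (Q R : (curve480a1.baseChange ℚ).toAffine.Point) :
    twoDescentComponent (curve480a1.baseChange ℚ).toAffine 0 (-2) 3 (Q + R) =
      twoDescentComponent (curve480a1.baseChange ℚ).toAffine 0 (-2) 3 Q *
        twoDescentComponent (curve480a1.baseChange ℚ).toAffine 0 (-2) 3 R := by
  haveI := isElliptic
  exact twoDescentComponent_add splitTwoTorsion Q R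

/-- `δ₂` is a homomorphism. [folklore] -/
theorem δ₂_add (Q R : (curve480a1.baseChange ℚ).toAffine.Point) :
    twoDescentComponent (curve480a1.baseChange ℚ).toAffine (-2) 0 3 (Q + R) =
      twoDescentComponent (curve480a1.baseChange ℚ).toAffine (-2) 0 3 Q *
        twoDescentComponent (curve480a1.baseChange ℚ).toAffine (-2) 0 3 R := by
  haveI := isElliptic
  exact twoDescentComponent_add splitTwoTorsion.swap₁₂ Q R

/-- `δ₁ (2Q) = 1`. [folklore] -/
theorem δ₁_two_nsmul (Q : (curve480a1.baseChange ℚ).toAffine.Point) :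
    twoDescentComponent (curve480a1.baseChange ℚ).toAffine 0 (-2) 3 (2 • Q) = 1 := by
  rw [two_nsmul, δ₁_add, SqUnits.mul_self]

/-- `δ₂ (2Q) = 1`. [folklore] -/
theorem δ₂_two_nsmul (Q : (curve480a1.baseChange ℚ).toAffine.Point) :
    twoDescentComponent (curve480a1.baseChange ℚ).toAffine (-2) 0 3 (2 • Q) = 1 := by
  rw [two_nsmul, δ₂_add, SqUnits.mul_self]

/-- `δ₁ (nQ) = δ₁ Q` for `n` odd. [folklore] -/
theorem δ₁_nsmul_odd {n : ℕ} (hn : Odd n) (Q : (curve480a1.baseChange ℚ).toAffine.Point) :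
    twoDescentComponent (curve480a1.baseChange ℚ).toAffine 0 (-2) 3 (n • Q) =
      twoDescentComponent (curve480a1.baseChange ℚ).toAffine 0 (-2) 3 Q := by
  obtain ⟨k, rfl⟩ := hn
  rw [add_nsmul, one_nsmul, mul_nsmul', δ₁_add, δ₁_two_nsmul, SqUnits.one_mul]

/-- `δ₂ (nQ) = δ₂ Q` for `n` odd. [folklore] -/
theorem δ₂_nsmul_odd {n : ℕ} (hn : Odd n) (Q : (curve480a1.baseChange ℚ).toAffine.Point) :
    twoDescentComponent (curve480a1.baseChange ℚ).toAffine (-2) 0 3 (n • Q) =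
      twoDescentComponent (curve480a1.baseChange ℚ).toAffine (-2) 0 3 Q := by
  obtain ⟨k, rfl⟩ := hn
  rw [add_nsmul, one_nsmul, mul_nsmul', δ₂_add, δ₂_two_nsmul, SqUnits.one_mul]

/-- `δ₁ P = [-1 - 0] = [-1] ≠ 1` (`-1` is not a square in `ℚ`). [folklore] -/
theorem δ₁_P :
    twoDescentComponent (curve480a1.baseChange ℚ).toAffine 0 (-2) 3 (.some (-1) 2 nonsingular_P) ≠
      1 := by
  rw [twoDescentComponent_some_of_ne _ (by norm_num)]
  norm_num
  exact sqClass_ne_one (by norm_num) not_isSquare_neg_one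

/-- `δ₂ P = [-1 + 2] = [1] = 1`. [folklore] -/
theorem δ₂_P :
    twoDescentComponent (curve480a1.baseChange ℚ).toAffine (-2) 0 3 (.some (-1) 2 nonsingular_P) =
      1 := by
  rw [twoDescentComponent_some_of_ne _ (by norm_num)]
  norm_num
  simpa using sqClass_sq (1 : ℚ)

/-- **The `2`-torsion of `480a1`**: an affine point `T = (x, y)` with `2T = O` has `y = -y`, so
`y = 0` and `x(x+2)(x-3) = 0`: `x ∈ {0, -2, 3}`. [folklore] -/
theorem x_eq_of_two_nsmul_eq_zero {x y : ℚ} {h : (curve480a1.baseChange ℚ).toAffine.Nonsingular x y}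
    (h2 : (2 : ℕ) • (Point.some x y h) = 0) : x = 0 ∨ x = -2 ∨ x = 3 := by
  rw [two_nsmul, add_eq_zero_iff_eq_neg, neg_some, some.injEq] at h2
  have hy : y = 0 := by
    have := h2.2
    rw [negY, E_a₁, E_a₃] at this
    linarith
  have heq := (equation_iff' x y).mp h.1
  rw [hy] at heq
  have : x * (x + 2) * (x - 3) = 0 := by linear_combination -heq
  rcases mul_eq_zero.mp this with h' | h'
  · rcases mul_eq_zero.mp h' with h'' | h''
    · exact Or.inl h''
    · exact Or.inr (Or.inl (by linarith))
  · exact Or.inr (Or.inr (by linarith))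

/-- **`δ₂` is non-trivial on the points of order `2`**: `δ₂(0, 0) = [2]`,
`δ₂(-2, 0) = [(-2 - 0)(-2 - 3)] = [10]`, `δ₂(3, 0) = [5]`, and `2, 10, 5` are not squares in `ℚ`.
[folklore] -/
theorem δ₂_ne_one_of_two_nsmul_eq_zero {x y : ℚ}
    {h : (curve480a1.baseChange ℚ).toAffine.Nonsingular x y}
    (h2 : (2 : ℕ) • (Point.some x y h) = 0) :
    twoDescentComponent (curve480a1.baseChange ℚ).toAffine (-2) 0 3 (.some x y h) ≠ 1 := by
  rcases x_eq_of_two_nsmul_eq_zero h2 with rfl | rfl | rfl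
  · rw [twoDescentComponent_some_of_ne _ (by norm_num)]
    norm_num
    exact sqClass_ne_one (by norm_num) not_isSquare_two
  · rw [twoDescentComponent_some_of_eq _ rfl]
    norm_num
    exact sqClass_ne_one (by norm_num) not_isSquare_ten
  · rw [twoDescentComponent_some_of_ne _ (by norm_num)]
    norm_num
    exact sqClass_ne_one (by norm_num) not_isSquare_five

/-- A `2`-torsion point of `480a1(ℚ)` with `δ₂ = 1` (e.g. one in `2E(ℚ)`) is `O`; in particular
`480a1(ℚ)` has no point of order `4`. [folklore] -/
theorem eq_zero_of_two_nsmul_eq_zero {T : (curve480a1.baseChange ℚ).toAffine.Point}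
    (h2 : (2 : ℕ) • T = 0)
    (hδ : twoDescentComponent (curve480a1.baseChange ℚ).toAffine (-2) 0 3 T = 1) : T = 0 := by
  rcases T with _ | ⟨x, y, h⟩
  · rfl
  · exact absurd hδ (δ₂_ne_one_of_two_nsmul_eq_zero h2)

/-- `2ᵏ Q = O` forces `2Q = O` on `480a1(ℚ)` (the `2`-primary torsion is `E[2]`): if `k ≥ 2`,
`T = 2ᵏ⁻¹ Q` is a `2`-torsion point in `2E(ℚ)`, hence `O`; induct. [folklore] -/
theorem two_nsmul_eq_zero_of_two_pow_nsmul_eq_zero (Q : (curve480a1.baseChange ℚ).toAffine.Point) :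
    ∀ k : ℕ, (2 ^ k : ℕ) • Q = 0 → (2 : ℕ) • Q = 0
  | 0, h => by rw [pow_zero, one_nsmul] at h; rw [h, nsmul_zero]
  | 1, h => by rwa [pow_one] at h
  | k + 2, h => by
    have hT : (2 : ℕ) • ((2 ^ (k + 1) : ℕ) • Q) = 0 := by
      rw [← mul_nsmul, ← pow_succ, h]
    have hT' : (2 ^ (k + 1) : ℕ) • Q = 0 :=
      eq_zero_of_two_nsmul_eq_zero hT (by rw [pow_succ, mul_nsmul, δ₂_two_nsmul])
    exact two_nsmul_eq_zero_of_two_pow_nsmul_eq_zero Q (k + 1) hT'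

/-- **`P = (-1, 2)` has infinite order in `480a1(ℚ)`.** If `nP = O` with `n = 2ᵏ m`, `m` odd,
then `2(mP) = O` (`two_nsmul_eq_zero_of_two_pow_nsmul_eq_zero`) and `δ(mP) = δ(P) = ([-1], 1)`
(`m` odd); `δ₂(mP) = 1` forces `mP = O`, contradicting `δ₁(mP) = [-1] ≠ 1`. (A `2`-descent
replacement for the Lutz–Nagell / reduction argument, neither of which is in Mathlib.) [folklore] -/
theorem nsmul_P_ne_zero {n : ℕ} (hn : 0 < n) :
    n • (Point.some (-1) 2 nonsingular_P : (curve480a1.baseChange ℚ).toAffine.Point) ≠ 0 := by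
  intro h
  obtain ⟨k, m, hm, rfl⟩ := Nat.exists_eq_two_pow_mul_odd hn.ne'
  rw [mul_comm, mul_nsmul] at h
  have h2 := two_nsmul_eq_zero_of_two_pow_nsmul_eq_zero _ k h
  have h0 : m • (Point.some (-1) 2 nonsingular_P) = 0 :=
    eq_zero_of_two_nsmul_eq_zero h2 (by rw [δ₂_nsmul_odd hm, δ₂_P])
  have := δ₁_nsmul_odd hm (.some (-1) 2 nonsingular_P)
  rw [h0, twoDescentComponent_zero] at this
  exact δ₁_P this.symm

/-- **`480a1` has a rational point of infinite order** (namely `P = (-1, 2)`), stated on the model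
`curve480a1.baseChange ℚ` from which `WeierstrassCurve.Affine.Point.baseChange ℚ F` maps to
`E(F)` for every number field `F`; so `rank_ℤ E(F) ≥ 1` for all `F` (with Mordell–Weil).
Cremona's tables list `480a1` with rank `1` and generator `(-1, 2)`; only the infinite order is
proved here. [folklore] -/
theorem exists_nsmul_ne_zero :
    ∃ Q : (curve480a1.baseChange ℚ).toAffine.Point, ∀ n : ℕ, 0 < n → n • Q ≠ 0 :=
  ⟨.some (-1) 2 nonsingular_P, fun _ hn => nsmul_P_ne_zero hn⟩

end curve480a1

end Literature.Barriers.BirchSwinnertonDyer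

end
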